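import Mathlib.FieldTheory.Galois.Infinite
import Mathlib.FieldTheory.KrullTopology
import Mathlib.FieldTheory.Normal.Closure
import Mathlib.FieldTheory.Minpoly.Field
import Mathlib.CategoryTheory.Comma.Over.Basic
import Mathlib.CategoryTheory.Endomorphism
import Mathlib.GroupTheory.Index
import Mathlib.GroupTheory.QuotientGroup.Basic
import Literature.AlgebraicGeometry.Frobenioids.FinSubextCat
import HarnessLib

/-!
# Frobenioids I, §6: automorphisms of the forgetful functors `D_A → D` for `D = B(G)⁰` — PROOFS
# (Theorem 6.2 (iv) / Theorem 6.4 (i), base-category part: Frobenius-slimness, and the map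
# `Z_G(Gal(K/L)) → Aut(D_{Spec L} → D)`)

Mochizuki, *The geometry of Frobenioids I*, Kyushu J. Math. **62** (2008), kurims text p. 111 (Thm. 6.2
(iv)), p. 112 (its proof: "there is a natural isomorphism `Z_G(H) ≅ Aut(D_{Spec(L)} → D)` [cf. [Mzk7],
Corollary 1.1.6]. Since `G` is profinite, hence, in particular, residually finite, it follows formally
that `Z`, `Z_G(H)` are also residually finite, hence that `D` is Frobenius-slim, by Remark 3.1.2"),
p. 114 (Thm. 6.4 (i)). [cite: MochizukiFrdI2008, Thm. 6.2 (iv) p.111]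

Here `D = FinSubextCat F K` (abc-iut-L1-t3: finite subextensions of `K/F`, morphisms `Spec L → Spec M` =
`F`-algebra maps `M → L`), `G = Gal(K/F) = K ≃ₐ[F] K` (Krull topology), `Z = commOpenSubgroup F K`.
PROOF-ONLY companion (discharge seat abc-iut-L6-t10, D-ζ-c); no statement of abc-iut-L1-t3 is restated.
PROVED, sorry-free: `exists_normal_finiteIndex_not_mem` — `Aut(D_A → D)` is residually finite, for any
`K/F` (it embeds in the product of the finite groups `Aut_F(L')`; the named corollaries
`IsResiduallyFiniteGroup` / `IsFrobeniusSlim (FinSubextCat F K)` = Thm. 6.2 (iv) first assertion /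
Thm. 6.4 (i) "`D` is Frobenius-slim", via Rem. 3.1.2, are in `FinSubextCatFrobeniusSlim.lean`); and, for
`K/F` Galois, the construction `autForgetOfCentralizer : z ∈ Z_G(Gal(K/A.L)) ↦ Aut(D_A → D)` with all
naturalities. The inverse construction and the slimness criterion are in `FinSubextCatSlim.lean`.
-/

noncomputable section

namespace Literature.AlgebraicGeometry.Frobenioids

open CategoryTheory IntermediateField

universe u

namespace FinSubextCat

variable {F : Type u} [Field F] {K : Type u} [Field K] [Algebra F K]

/-! ### Basic API of `D = FinSubextCat F K` -/

/-- Unfolding of identities. [cite: MochizukiFrdI2008, Ex. 6.3 p.113] -/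
@[simp] theorem id_toAlgHom (X : FinSubextCat F K) : (𝟙 X : X ⟶ X).toAlgHom = AlgHom.id F X.L := rfl

/-- Unfolding of composition (note the reversal: `Spec` is contravariant). [cite: MochizukiFrdI2008, Ex. 6.3 p.113] -/
@[simp] theorem comp_toAlgHom {X Y Z : FinSubextCat F K} (f : X ⟶ Y) (g : Y ⟶ Z) :
    (f ≫ g).toAlgHom = f.toAlgHom.comp g.toAlgHom := rfl

/-- The automorphism group of `Spec L` in `D` is finite (it injects into `Hom_F(L, L)`).
[cite: MochizukiFrdI2008, Ex. 6.3 p.113] -/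
instance finite_aut (X : FinSubextCat F K) : Finite (Aut X) := by
  haveI : Fintype (X.L →ₐ[F] X.L) := minpoly.AlgHom.fintype F X.L X.L
  exact Finite.of_injective (fun α : Aut X => α.hom.toAlgHom) fun α β h => Iso.ext (hom_ext h)

/-- The isomorphism `Spec L ≅ Spec L` of `D` determined by an `F`-algebra automorphism of `L`.
[cite: MochizukiFrdI2008, Ex. 6.3 p.113] -/
def isoOfAlgEquiv (X : FinSubextCat F K) (e : X.L ≃ₐ[F] X.L) : X ≅ X where
  hom := ⟨(e : X.L →ₐ[F] X.L)⟩
  inv := ⟨(e.symm : X.L →ₐ[F] X.L)⟩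
  hom_inv_id := hom_ext (by ext x; simp)
  inv_hom_id := hom_ext (by ext x; simp)

/-- Restriction of an `F`-algebra endomorphism of `K` to intermediate fields it maps into one another.
[cite: MochizukiFrdI2008, Ex. 6.3 p.113] -/
def restrictAlgHom (g : K →ₐ[F] K) (L₁ L₂ : IntermediateField F K) (hg : ∀ x ∈ L₁, g x ∈ L₂) :
    L₁ →ₐ[F] L₂ where
  toFun x := ⟨g x, hg x x.2⟩
  map_one' := Subtype.ext (by simp)
  map_mul' x y := Subtype.ext (by simp)
  map_zero' := Subtype.ext (by simp)
  map_add' x y := Subtype.ext (by simp)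
  commutes' r := Subtype.ext (by simp)

/-- Underlying value of the restricted map. [cite: MochizukiFrdI2008, Thm. 6.2 (iv) p.112] -/
@[simp] theorem coe_restrictAlgHom (g : K →ₐ[F] K) (L₁ L₂ : IntermediateField F K)
    (hg : ∀ x ∈ L₁, g x ∈ L₂) (x : L₁) : (restrictAlgHom g L₁ L₂ hg x : K) = g x := rfl

/-! ### `Aut(D_A → D)` is residually finite, hence `D` is Frobenius-slim (FrdI p. 112, Rem. 3.1.2) -/

/-- Evaluation of an automorphism of the forgetful functor `D_A → D` at an object of `D_A`, as a group
homomorphism to the (finite) automorphism group of the underlying object. [cite: MochizukiFrdI2008, Thm. 6.2 (iv) p.112] -/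
def autForgetApp (A : FinSubextCat F K) (B : Over A) : Aut (Over.forget A) →* Aut B.left where
  toFun α := α.app B
  map_one' := rfl
  map_mul' _ _ := rfl

/-- "Since `G` is profinite, hence, in particular, residually finite, it follows formally that `Z`, `Z_G(H)`
[`≅ Aut(D_{Spec(L)} → D)`] are also residually finite" (FrdI p. 112) — PROVED directly, for an arbitrary
field extension `K/F`, in unfolded form: a nontrivial automorphism of `D_A → D` lies outside some normal
subgroup of finite index (the kernel of the evaluation at a component where it is nontrivial; that
component's automorphism group is finite). [cite: MochizukiFrdI2008, Thm. 6.2 (iv) p.112] -/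
theorem exists_normal_finiteIndex_not_mem (A : FinSubextCat F K) (α : Aut (Over.forget A))
    (hα : α ≠ 1) : ∃ N : Subgroup (Aut (Over.forget A)), N.Normal ∧ N.FiniteIndex ∧ α ∉ N := by
  obtain ⟨B, hB⟩ : ∃ B : Over A, autForgetApp A B α ≠ 1 := by
    by_contra h
    push Not at h
    refine hα (Iso.ext (NatTrans.ext (funext fun B => ?_)))
    have hB : (α.app B).hom = (1 : Aut B.left).hom := congrArg Iso.hom (h B)
    exact hB
  refine ⟨(autForgetApp A B).ker, inferInstance, ?_, fun hmem => hB ((MonoidHom.mem_ker).mp hmem)⟩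
  haveI : Finite (Aut (Over.forget A) ⧸ (autForgetApp A B).ker) :=
    Finite.of_equiv _ (QuotientGroup.quotientKerEquivRange (autForgetApp A B)).symm.toEquiv
  exact Subgroup.finiteIndex_of_finite_quotient

/-! ### Objects of `D_A` given by inclusions, and extensions of embeddings to `G = Gal(K/F)` -/

section Galois

variable (A : FinSubextCat F K)

/-- The object `(Spec L' → Spec A.L)` of `D_A` given by an intermediate field `L' ⊇ A.L`, structure map
the inclusion. [cite: MochizukiFrdI2008, Thm. 6.2 (iv) p.112] -/
def overIncl (L' : IntermediateField F K) [FiniteDimensional F L'] (h : A.L ≤ L') : Over A :=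
  Over.mk (Y := (⟨L'⟩ : FinSubextCat F K)) ⟨IntermediateField.inclusion h⟩

/-- The underlying object of `overIncl` is `Spec L'`. [cite: MochizukiFrdI2008, Thm. 6.2 (iv) p.112] -/
@[simp] theorem overIncl_left (L' : IntermediateField F K) [FiniteDimensional F L'] (h : A.L ≤ L') :
    (overIncl A L' h).left = ⟨L'⟩ := rfl

/-- The structure map of `overIncl` is the inclusion. [cite: MochizukiFrdI2008, Thm. 6.2 (iv) p.112] -/
@[simp] theorem overIncl_hom_toAlgHom (L' : IntermediateField F K) [FiniteDimensional F L']
    (h : A.L ≤ L') : (overIncl A L' h).hom.toAlgHom = IntermediateField.inclusion h := rfl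

/-- The morphism `overIncl L₂ ⟶ overIncl L₁` of `D_A` given by `L₁ ≤ L₂`. [cite: MochizukiFrdI2008, Thm. 6.2 (iv) p.112] -/
def overInclHom {L₁ L₂ : IntermediateField F K} [FiniteDimensional F L₁] [FiniteDimensional F L₂]
    (h₁ : A.L ≤ L₁) (h₁₂ : L₁ ≤ L₂) : overIncl A L₂ (h₁.trans h₁₂) ⟶ overIncl A L₁ h₁ :=
  Over.homMk ⟨IntermediateField.inclusion h₁₂⟩ (hom_ext (AlgHom.ext fun _ => rfl))

/-- The component of an automorphism `α` of the forgetful functor `D_A → D` at an object `B` of `D_A`,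
as an `F`-algebra endomorphism of the field of `B`. [cite: MochizukiFrdI2008, Thm. 6.2 (iv) p.112] -/
def objApp (α : Over.forget A ≅ Over.forget A) (B : Over A) : B.left.L →ₐ[F] B.left.L :=
  (α.hom.app B).toAlgHom

/-- The component of `α` at `(Spec L' → Spec A.L)` (structure map the inclusion), as an `F`-algebra
endomorphism of `L'`. [cite: MochizukiFrdI2008, Thm. 6.2 (iv) p.112] -/
def inclApp (α : Over.forget A ≅ Over.forget A) (L' : IntermediateField F K) [FiniteDimensional F L']
    (h : A.L ≤ L') : L' →ₐ[F] L' :=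
  (α.hom.app (overIncl A L' h)).toAlgHom

/-- Compatibility of the components of an automorphism of `D_A → D` along inclusions `L₁ ≤ L₂`.
[cite: MochizukiFrdI2008, Thm. 6.2 (iv) p.112] -/
theorem inclApp_compat (α : Over.forget A ≅ Over.forget A) {L₁ L₂ : IntermediateField F K}
    [FiniteDimensional F L₁] [FiniteDimensional F L₂] (h₁ : A.L ≤ L₁) (h₁₂ : L₁ ≤ L₂) (y : L₁) :
    (inclApp A α L₂ (h₁.trans h₁₂) (IntermediateField.inclusion h₁₂ y) : K) =
      (inclApp A α L₁ h₁ y : K) := by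
  have nat := α.hom.naturality (overInclHom A h₁ h₁₂)
  have key : (IntermediateField.inclusion h₁₂ (inclApp A α L₁ h₁ y) : K) =
      (inclApp A α L₂ (h₁.trans h₁₂) (IntermediateField.inclusion h₁₂ y) : K) :=
    congrArg (fun f : ((⟨L₂⟩ : FinSubextCat F K) ⟶ ⟨L₁⟩) => (f.toAlgHom y : K)) nat
  exact key.symm

variable [IsGalois F K]

/-- An extension of an `F`-embedding `L → K` of an intermediate field to an element of `G = Gal(K/F)`
(`K/F` is normal). [cite: MochizukiFrdI2008, Thm. 6.2 (iv) p.112] -/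
def liftEquiv (L : IntermediateField F K) (ι : L →ₐ[F] K) : K ≃ₐ[F] K :=
  AlgEquiv.ofBijective (ι.liftNormal K) (AlgHom.normal_bijective F K K _)

/-- The lift extends the given embedding. [cite: MochizukiFrdI2008, Thm. 6.2 (iv) p.112] -/
theorem liftEquiv_apply_coe (L : IntermediateField F K) (ι : L →ₐ[F] K) (a : L) :
    liftEquiv L ι a = ι a := by
  show ι.liftNormal K (algebraMap L K a) = _
  rw [AlgHom.liftNormal_commutes]
  rfl

omit [IsGalois F K] in
/-- If `g₁, g₂ ∈ G` agree on `L` and `z` centralizes `Gal(K/L)`, then `g₁ z g₁⁻¹ = g₂ z g₂⁻¹`.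
[cite: MochizukiFrdI2008, Thm. 6.2 (iv) p.112] -/
theorem conj_eq_conj_of_agree {L : IntermediateField F K} {z : K ≃ₐ[F] K}
    (hz : ∀ h ∈ L.fixingSubgroup, z * h = h * z) {g₁ g₂ : K ≃ₐ[F] K}
    (hg : ∀ a : L, g₁ a = g₂ a) : g₁ * z * g₁⁻¹ = g₂ * z * g₂⁻¹ := by
  have hmem : g₂⁻¹ * g₁ ∈ L.fixingSubgroup := by
    rw [IntermediateField.mem_fixingSubgroup_iff]
    intro x hx
    rw [AlgEquiv.mul_apply, hg ⟨x, hx⟩, AlgEquiv.aut_inv, AlgEquiv.symm_apply_apply]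
  have hc := hz _ hmem
  calc g₁ * z * g₁⁻¹ = g₂ * ((g₂⁻¹ * g₁) * z) * g₁⁻¹ := by group
    _ = g₂ * (z * (g₂⁻¹ * g₁)) * g₁⁻¹ := by rw [hc]
    _ = g₂ * z * g₂⁻¹ := by group

/-- An element of `G` centralizing `Gal(K/L)` maps every intermediate field containing `L` into itself
(Galois correspondence for `K/F`). [cite: MochizukiFrdI2008, Thm. 6.2 (iv) p.112] -/
theorem apply_mem_of_centralizes {L : IntermediateField F K} {z : K ≃ₐ[F] K}
    (hz : ∀ h ∈ L.fixingSubgroup, z * h = h * z) {L₀ : IntermediateField F K} (hL : L ≤ L₀)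
    {x : K} (hx : x ∈ L₀) : z x ∈ L₀ := by
  rw [← InfiniteGalois.fixedField_fixingSubgroup L₀, IntermediateField.mem_fixedField_iff]
  intro h hh
  have hh' : h ∈ L.fixingSubgroup := IntermediateField.fixingSubgroup_antitone hL hh
  have hc := hz h hh'
  have hfix : h x = x := (IntermediateField.mem_fixingSubgroup_iff L₀ h).mp hh x hx
  calc h (z x) = (h * z) x := rfl
    _ = (z * h) x := by rw [hc]
    _ = z (h x) := rfl
    _ = z x := by rw [hfix]

/-! ### From `z ∈ Z_G(Gal(K/A.L))` to an automorphism of `D_A → D` (FrdI p. 112) -/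

/-- A chosen extension `g_B ∈ G` of the structure embedding `A.L → L' ⊆ K` of an object
`B = (Spec L' → Spec A.L)` of `D_A`. [cite: MochizukiFrdI2008, Thm. 6.2 (iv) p.112] -/
def overLift (B : Over A) : K ≃ₐ[F] K := liftEquiv A.L (B.left.L.val.comp B.hom.toAlgHom)

/-- `g_B` extends the structure embedding of `B`. [cite: MochizukiFrdI2008, Thm. 6.2 (iv) p.112] -/
theorem overLift_apply (B : Over A) (a : A.L) : overLift A B a = (B.hom.toAlgHom a : K) :=
  liftEquiv_apply_coe _ _ a

/-- `g_B z g_B⁻¹`. [cite: MochizukiFrdI2008, Thm. 6.2 (iv) p.112] -/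
def overConj (z : K ≃ₐ[F] K) (B : Over A) : K ≃ₐ[F] K := overLift A B * z * (overLift A B)⁻¹

variable {A}

/-- `g_B z g_B⁻¹` does not depend on the choice of the extension `g_B` (`z` centralizes `Gal(K/A.L)`). [cite: MochizukiFrdI2008, Thm. 6.2 (iv) p.112] -/
theorem overConj_eq {z : K ≃ₐ[F] K} (hz : ∀ h ∈ A.L.fixingSubgroup, z * h = h * z) (B : Over A)
    {g : K ≃ₐ[F] K} (hg : ∀ a : A.L, g a = (B.hom.toAlgHom a : K)) : overConj A z B = g * z * g⁻¹ :=
  conj_eq_conj_of_agree hz fun a => by rw [overLift_apply, hg]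

/-- `A.L ⊆ g_B⁻¹(L')`. [cite: MochizukiFrdI2008, Thm. 6.2 (iv) p.112] -/
theorem le_map_overLift_symm (B : Over A) :
    A.L ≤ B.left.L.map ((overLift A B).symm : K →ₐ[F] K) := by
  intro a ha
  refine (IntermediateField.mem_map _).mpr
    ⟨(B.hom.toAlgHom ⟨a, ha⟩ : K), (B.hom.toAlgHom ⟨a, ha⟩).2, ?_⟩
  rw [AlgEquiv.coe_toAlgHom, ← overLift_apply]
  exact (overLift A B).symm_apply_apply a

/-- `g_B z g_B⁻¹` maps `L'` into itself. [cite: MochizukiFrdI2008, Thm. 6.2 (iv) p.112] -/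
theorem overConj_apply_mem {z : K ≃ₐ[F] K} (hz : ∀ h ∈ A.L.fixingSubgroup, z * h = h * z)
    (B : Over A) {x : K} (hx : x ∈ B.left.L) : overConj A z B x ∈ B.left.L := by
  have hx' : (overLift A B).symm x ∈ B.left.L.map ((overLift A B).symm : K →ₐ[F] K) :=
    (IntermediateField.mem_map _).mpr ⟨x, hx, rfl⟩
  obtain ⟨y, hy, hyx⟩ :=
    (IntermediateField.mem_map _).mp (apply_mem_of_centralizes hz (le_map_overLift_symm B) hx')
  rw [AlgEquiv.coe_toAlgHom] at hyx
  have h1 : overConj A z B x = overLift A B (z ((overLift A B).symm x)) := by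
    simp only [overConj, AlgEquiv.mul_apply, AlgEquiv.aut_inv]
  rw [h1, ← hyx, AlgEquiv.apply_symm_apply]
  exact hy

/-- The component at `B = (Spec L' → Spec A.L)` of the automorphism of `D_A → D` attached to
`z ∈ Z_G(Gal(K/A.L))`: the automorphism `g_B z g_B⁻¹|_{L'}` of `Spec L'`.
[cite: MochizukiFrdI2008, Thm. 6.2 (iv) p.112] -/
def autForgetOfCentralizerApp {z : K ≃ₐ[F] K} (hz : ∀ h ∈ A.L.fixingSubgroup, z * h = h * z)
    (B : Over A) : B.left ≅ B.left :=
  isoOfAlgEquiv B.left (AlgEquiv.ofBijective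
    (restrictAlgHom (overConj A z B : K →ₐ[F] K) B.left.L B.left.L
      (fun _ hx => overConj_apply_mem hz B hx))
    (Algebra.IsAlgebraic.algHom_bijective _))

/-- The component at `B` is `g_B z g_B⁻¹|_{L'}` (as an element of `L'`). [cite: MochizukiFrdI2008, Thm. 6.2 (iv) p.112] -/
theorem autForgetOfCentralizerApp_toAlgHom_apply {z : K ≃ₐ[F] K}
    (hz : ∀ h ∈ A.L.fixingSubgroup, z * h = h * z) (B : Over A) (y : B.left.L) :
    (autForgetOfCentralizerApp hz B).hom.toAlgHom y = ⟨overConj A z B y, overConj_apply_mem hz B y.2⟩ :=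
  rfl

/-- The component at `B` is `g_B z g_B⁻¹|_{L'}` (values in `K`). [cite: MochizukiFrdI2008, Thm. 6.2 (iv) p.112] -/
@[simp] theorem autForgetOfCentralizerApp_apply {z : K ≃ₐ[F] K}
    (hz : ∀ h ∈ A.L.fixingSubgroup, z * h = h * z) (B : Over A) (y : B.left.L) :
    (((autForgetOfCentralizerApp hz B).hom).toAlgHom y : K) = overConj A z B y := rfl

/-- The automorphism of the forgetful functor `D_A → D` attached to `z ∈ Z_G(Gal(K/A.L))` — the map
`Z_G(H) → Aut(D_{Spec(L)} → D)` of FrdI p. 112, with its naturality PROVED.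
[cite: MochizukiFrdI2008, Thm. 6.2 (iv) p.112] -/
def autForgetOfCentralizer {z : K ≃ₐ[F] K} (hz : ∀ h ∈ A.L.fixingSubgroup, z * h = h * z) :
    Over.forget A ≅ Over.forget A :=
  NatIso.ofComponents (fun B => autForgetOfCentralizerApp hz B) (by
    intro B B' φ
    dsimp only [Over.forget_obj, Over.forget_map]
    refine hom_ext (AlgHom.ext fun y => Subtype.ext ?_)
    simp only [comp_toAlgHom, AlgHom.comp_apply, autForgetOfCentralizerApp_apply]
    rw [autForgetOfCentralizerApp_toAlgHom_apply]
    set t := liftEquiv B'.left.L (B.left.L.val.comp φ.left.toAlgHom) with htdef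
    have ht : ∀ w : B'.left.L, t w = (φ.left.toAlgHom w : K) := fun w => liftEquiv_apply_coe _ _ w
    have hg : ∀ a : A.L, (t * overLift A B') a = (B.hom.toAlgHom a : K) := fun a => by
      rw [AlgEquiv.mul_apply, overLift_apply, ht, ← Over.w φ]
      rfl
    rw [← ht, ← ht, overConj_eq hz B hg]
    simp only [overConj, AlgEquiv.mul_apply, mul_inv_rev, AlgEquiv.aut_inv,
      AlgEquiv.symm_apply_apply])

/-- The components of `autForgetOfCentralizer` are the `g_B z g_B⁻¹|_{L'}`. [cite: MochizukiFrdI2008, Thm. 6.2 (iv) p.112] -/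
@[simp] theorem autForgetOfCentralizer_app_apply {z : K ≃ₐ[F] K}
    (hz : ∀ h ∈ A.L.fixingSubgroup, z * h = h * z) (B : Over A) (y : B.left.L) :
    (((autForgetOfCentralizer hz).hom.app B).toAlgHom y : K) = overConj A z B y := rfl

end Galois

end FinSubextCat

end Literature.AlgebraicGeometry.Frobenioids

end
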